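import Summits.ValiantsHypothesis.ValiantsHypothesis.Theorems.NewtonUnitEquationsTwoProductsConfinedTameLawChartMain
import Summits.ValiantsHypothesis.ValiantsHypothesis.Theorems.NewtonUnitEquationsTwoProductsRankOneSchemaLawPlanar
import HarnessLib

/-!
# R10 (`positive-circuit-chart`) — ENGINE F3: the CHART LIFT of the chain difference (R9 `…RankOneSchemaLawPlanar` with `frM ↦ M`)
Abstract chart data `ChartData u v` (what `R10.positiveCircuitChart_holds` delivers for the realised relation lattice of the tail
alphabet, plus the generator property «equal planar sums of tuples ⇒ table difference ∈ Λ»); the lift `GT := phiT M (liftG cU cV)`;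
its dilated push-forward `phi G GT = phi (dilE D) (tailDiff u v)`; ONE upstairs monomial per planar point (`injOn_of_chart`, from
`Λ ⊆ ker M`); visible points lift to strict maxima (`lifted_of_visible`, verbatim R9).
R275 P3 scope: tool for the proper positive sub-case rung `ConfinedTameLaw`; nothing here closes 5906; VP ≠ VNP is NOT proved.
-/

noncomputable section
set_option linter.dupNamespace false
set_option linter.unusedSectionVars false

namespace Summit.ValiantsHypothesis.ValiantsHypothesis.Theorems.NewtonUnitEquations.TwoProducts.PermutationType
namespace R10
open scoped BigOperators
open MvPolynomial
open Summit.ValiantsHypothesis.ValiantsHypothesis.Theorems.NewtonUnitEquations.TwoProducts.FormalLogLinearisation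
open Summit.ValiantsHypothesis.ValiantsHypothesis.Theorems.NewtonUnitEquations.TwoProducts.PlanarCell

section Lift
variable {m : ℕ}
variable (u v : Fin m → MvPolynomial (Fin 2) ℂ)

/-- The integer table of a letter exponent vector on the tail alphabet. [folklore] -/
def tableZ (L : Fin (sE u v) →₀ ℕ) : Fin (sE u v) → ℤ := fun k => (L k : ℤ)

/-- **Chart data** for the tail alphabet of `(u, v)`: a nonnegative integer lift `M` of the letters into `N` atoms with no letter sent to
`0`, a dilation `D > 0` and a planar push-forward `G` (`Σ_a M k a • G a = D • enum k`), a lattice `Λ` containing the table differences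
of planarly-coinciding letter vectors realised by the chains, whose saturation is the integer kernel of `M`, and the weight transfer
(every strictly positive `Λ`-orthogonal real weight is `c⁻¹ Σ_a θ_a M(·) a` with `θ ≥ 1`).  Produced by `R10.positiveCircuitChart_holds`. -/
structure ChartData where
  /-- number of atoms -/
  N : ℕ
  /-- the lift of the letters -/
  M : Fin (sE u v) → (Fin N →₀ ℕ)
  /-- the dilation -/
  D : ℕ
  /-- the planar push-forward of the atoms -/
  G : Fin N → Expo
  /-- the relation lattice -/
  Λ : Submodule ℤ (Fin (sE u v) → ℤ)
  hM0 : ∀ k, M k ≠ 0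
  hD : 0 < D
  hG : ∀ k, D • enum u v k = ∑ a, (M k) a • G a
  hgen : ∀ L L' : Fin (sE u v) →₀ ℕ, L ∈ (liftG (cU u v) (cV u v)).support → L' ∈ (liftG (cU u v) (cV u v)).support →
    piE (enum u v) L = piE (enum u v) L' → (tableZ u v L - tableZ u v L') ∈ Λ
  hker : ∀ z : Fin (sE u v) → ℤ, (∀ a : Fin N, ∑ i, z i * ((M i) a : ℤ) = 0) ↔ ∃ k : ℕ, 0 < k ∧ (fun i => (k : ℤ) * z i) ∈ Λ
  hwt : ∀ r : Fin (sE u v) → ℝ, (∀ i, 0 < r i) → (∀ z ∈ Λ, ∑ i, (z i : ℝ) * r i = 0) →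
    ∃ θ : Fin N → ℝ, (∀ a, 1 ≤ θ a) ∧ ∃ c : ℝ, 0 < c ∧ ∀ i, ∑ a, ((M i) a : ℝ) * θ a = c * r i

variable {u v}
variable (Ch : ChartData u v)

/-- `D ≥ 1`. [folklore] -/
theorem ChartData.D_pos : 1 ≤ Ch.D := Ch.hD

/-- Letter-wise: push-forward ∘ lift = dilation. [folklore] -/
theorem ChartData.comp_eq : (fun k => piT Ch.G (Ch.M k)) = fun k => piT (R7b.dilE Ch.D) (enum u v k) := by
  funext k
  rw [R7b.piT_dilE, Ch.hG k]
  ext c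
  rw [piT_apply, Finsupp.coe_finsetSum, Finset.sum_apply]
  exact Finset.sum_congr rfl fun a _ => by simp

/-- On exponents: push-forward ∘ lift = `D` · letter push-forward. [folklore] -/
theorem ChartData.piE_G_piT (L : Fin (sE u v) →₀ ℕ) : piE Ch.G (piT Ch.M L) = Ch.D • piE (enum u v) L := by
  rw [piE_eq_piT, piE_eq_piT, piT_piT, Ch.comp_eq, ← piT_piT, R7b.piT_dilE]

/-- On polynomials: push-forward ∘ lift = dilation ∘ letter push-forward. [folklore] -/
theorem ChartData.phi_G_phiT (H : MvPolynomial (Fin (sE u v)) ℂ) :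
    phi Ch.G (phiT Ch.M H) = phi (R7b.dilE Ch.D) (phi (enum u v) H) := by
  rw [phi_eq_phiT, phi_eq_phiT, phi_eq_phiT, phiT_phiT, Ch.comp_eq, ← phiT_phiT]

/-- The chart lift of the chain difference. [folklore] -/
def ChartData.GT : MvPolynomial (Fin Ch.N) ℂ := phiT Ch.M (liftG (cU u v) (cV u v))

/-- Its push-forward is the `D`-dilation of the planar difference of products. [folklore] -/
theorem ChartData.phi_GT : phi Ch.G Ch.GT = phi (R7b.dilE Ch.D) (tailDiff u v) := by
  unfold ChartData.GT
  rw [Ch.phi_G_phiT, phi_liftG]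

/-- Exponents of the lift are lifted chain exponents. [folklore] -/
theorem ChartData.exists_of_mem_support_GT (x : Fin Ch.N →₀ ℕ) (hx : x ∈ Ch.GT.support) :
    ∃ L ∈ (liftG (cU u v) (cV u v)).support, piT Ch.M L = x :=
  exists_of_mem_support_phiT Ch.M _ x hx

/-- The lift on exponents only sees the table modulo `ker M ⊇ Λ`. [folklore] -/
theorem ChartData.piT_eq_of_sub_mem {L L' : Fin (sE u v) →₀ ℕ} (h : (tableZ u v L - tableZ u v L') ∈ Ch.Λ) :
    piT Ch.M L = piT Ch.M L' := by
  have hk := (Ch.hker (tableZ u v L - tableZ u v L')).2 ⟨1, one_pos, by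
    have : (fun i => ((1 : ℕ) : ℤ) * (tableZ u v L - tableZ u v L') i) = tableZ u v L - tableZ u v L' := by
      funext i; simp
    rw [this]; exact h⟩
  ext a
  rw [piT_apply, piT_apply]
  have h1 := hk a
  simp only [Pi.sub_apply, tableZ, sub_mul, Finset.sum_sub_distrib, sub_eq_zero] at h1
  exact_mod_cast h1

/-- **One upstairs monomial per planar point**: the push-forward is injective on the support of the lift. [folklore] -/
theorem ChartData.injOn_of_chart : Set.InjOn (piE Ch.G) ↑Ch.GT.support := by
  intro x hx x' hx' hπ
  obtain ⟨L, hL, rfl⟩ := Ch.exists_of_mem_support_GT x hx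
  obtain ⟨L', hL', rfl⟩ := Ch.exists_of_mem_support_GT x' hx'
  rw [Ch.piE_G_piT, Ch.piE_G_piT] at hπ
  replace hπ := PlanarCell.eq_of_nsmul_eq Ch.D_pos hπ
  exact Ch.piT_eq_of_sub_mem (Ch.hgen L L' hL hL' hπ)

/-- **Visible points lift** (over `D · l`) to strict `ξ`-maxima of the lifted support. [folklore] -/
theorem ChartData.lifted_of_visible (ξ : Fin 2 → ℝ) (l : Expo) (htop : IsStrictTop ξ ↑(tailDiff u v).support l) :
    ∃ x₀ : Fin Ch.N →₀ ℕ, x₀ ∈ Ch.GT.support ∧ piE Ch.G x₀ = Ch.D • l ∧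
      ∀ x ∈ Ch.GT.support, x ≠ x₀ → wt ξ (piE Ch.G x) < wt ξ (Ch.D • l) := by
  have hinj := Ch.injOn_of_chart
  have hsupp : phi Ch.G Ch.GT = phi (R7b.dilE Ch.D) (tailDiff u v) := Ch.phi_GT
  have hinjD : Set.InjOn (piE (R7b.dilE Ch.D)) ↑(tailDiff u v).support := fun e _ e' _ h => by
    rw [R7b.piE_dilE, R7b.piE_dilE] at h; exact PlanarCell.eq_of_nsmul_eq Ch.D_pos h
  obtain ⟨hl, hlt⟩ := htop
  have hl' : Ch.D • l ∈ (phi Ch.G Ch.GT).support := by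
    rw [hsupp, mem_support_iff, ← R7b.piE_dilE Ch.D l, coeff_phi_of_injOn (R7b.dilE Ch.D) _ hinjD l hl]
    exact mem_support_iff.mp hl
  obtain ⟨x₀, hx₀, hπ⟩ := exists_of_mem_support_phi Ch.G _ _ hl'
  refine ⟨x₀, hx₀, hπ, fun x hx hne => ?_⟩
  have hmem : piE Ch.G x ∈ (phi (R7b.dilE Ch.D) (tailDiff u v)).support := by
    rw [← hsupp, mem_support_iff, coeff_phi_of_injOn Ch.G _ hinj x hx]
    exact mem_support_iff.mp hx
  obtain ⟨e, he, hπe⟩ := exists_of_mem_support_phi (R7b.dilE Ch.D) _ _ hmem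
  rw [R7b.piE_dilE] at hπe
  have hne' : e ≠ l := by
    intro h; apply hne; apply hinj hx hx₀; rw [← hπe, h, hπ]
  have h1 := hlt e he hne'
  rw [← hπe, wt_nsmul, wt_nsmul]
  have hp : (0 : ℝ) < Ch.D := by exact_mod_cast Ch.D_pos
  exact mul_lt_mul_of_pos_left h1 hp

/-- **Weight transfer on the lift**: for a valid cell weight `ξ` whose letter weights are `Λ`-orthogonal, upstairs weights `θ ≥ 1` and
`c > 0` with `lwt θ (piT M L) = c · Σ_k rW ξ k · L k` for every letter vector `L`. [folklore] -/
theorem ChartData.exists_theta (ξ : Fin 2 → ℝ) (hval : ValidWeight u v ξ)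
    (horth : ∀ z ∈ Ch.Λ, ∑ i, (z i : ℝ) * rW (u := u) (v := v) ξ i = 0) :
    ∃ θ : Fin Ch.N → ℝ, (∀ a, 1 ≤ θ a) ∧ ∃ c : ℝ, 0 < c ∧
      ∀ L : Fin (sE u v) →₀ ℕ, lwt θ (piT Ch.M L) = c * ∑ k, rW (u := u) (v := v) ξ k * (L k : ℝ) := by
  obtain ⟨θ, hθ, c, hc, hsum⟩ := Ch.hwt (rW (u := u) (v := v) ξ) (fun k => R6b.rW_pos ξ hval k) horth
  refine ⟨θ, hθ, c, hc, fun L => ?_⟩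
  unfold lwt
  have e1 : ∑ a, θ a * ((piT Ch.M L a : ℕ) : ℝ) = ∑ k, (L k : ℝ) * ∑ a, ((Ch.M k a : ℕ) : ℝ) * θ a := by
    simp only [piT_apply, Nat.cast_sum, Nat.cast_mul, Finset.mul_sum]
    rw [Finset.sum_comm]
    exact Finset.sum_congr rfl fun k _ => Finset.sum_congr rfl fun a _ => by ring
  rw [e1, Finset.mul_sum]
  exact Finset.sum_congr rfl fun k _ => by rw [hsum k]; ring

/-! ### Instantiation: chart data for every `(u, v)` from `positiveCircuitChart_holds` -/

variable (u v)

/-- The realised generator set: table differences of planarly-coinciding chain exponents. [folklore] -/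
def genSet : Set (Fin (sE u v) → ℤ) :=
  {z | ∃ L L' : Fin (sE u v) →₀ ℕ, L ∈ (liftG (cU u v) (cV u v)).support ∧ L' ∈ (liftG (cU u v) (cV u v)).support ∧
    piE (enum u v) L = piE (enum u v) L' ∧ z = tableZ u v L - tableZ u v L'}

/-- The realised relation lattice of the tail alphabet (index form). [folklore] -/
def relLat : Submodule ℤ (Fin (sE u v) → ℤ) := Submodule.span ℤ (genSet u v)

/-- The realised relation lattice lies in `ker σ`. [folklore] -/
theorem relLat_ker (z : Fin (sE u v) → ℤ) (hz : z ∈ relLat u v) (c : Fin 2) : ∑ i, z i * ((enum u v i) c : ℤ) = 0 := by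
  unfold relLat at hz
  induction hz using Submodule.span_induction with
  | mem x hx =>
    obtain ⟨L, L', -, -, hπ, rfl⟩ := hx
    have h := congrArg (fun e : Expo => (e c : ℤ)) hπ
    simp only [R9.piE_apply_coord, Nat.cast_sum, Nat.cast_mul] at h
    simp only [Pi.sub_apply, tableZ, sub_mul, Finset.sum_sub_distrib, h, sub_self]
  | zero => simp
  | add a b _ _ ha hb => simp only [Pi.add_apply, add_mul, Finset.sum_add_distrib, ha, hb, add_zero]
  | smul n a _ ha =>
    simp only [Pi.smul_apply, smul_eq_mul]
    have : ∑ i, n * a i * ((enum u v i) c : ℤ) = n * ∑ i, a i * ((enum u v i) c : ℤ) := by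
      rw [Finset.mul_sum]; exact Finset.sum_congr rfl fun i _ => by ring
    rw [this, ha, mul_zero]

/-- **Chart data exist for every cell problem** (letters nonzero because the constant terms vanish). [folklore] -/
theorem exists_chartData (hu : ∀ j, coeff 0 (u j) = 0) (hv : ∀ j, coeff 0 (v j) = 0) :
    ∃ Ch : ChartData u v, Ch.Λ = relLat u v := by
  obtain ⟨N, M, D, G, hM0, hD, hG, hker, hwt⟩ :=
    positiveCircuitChart_holds (Fin (sE u v)) (enum u v) (enum_ne_zero u v hu hv) (relLat u v) (fun z hz c => relLat_ker u v z hz c)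
  refine ⟨⟨N, M, D, G, relLat u v, hM0, hD, hG, fun L L' hL hL' hπ => ?_, hker, hwt⟩, rfl⟩
  exact Submodule.subset_span ⟨L, L', hL, hL', hπ, rfl⟩

end Lift

end R10
end Summit.ValiantsHypothesis.ValiantsHypothesis.Theorems.NewtonUnitEquations.TwoProducts.PermutationType

end
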